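import Literature.AlgebraicGeometry.Motives.ProjectiveSpaceLinearMaps
import HarnessLib

/-!
# Linear maps `ℙʳ_k → ℙᴺ_k` hitting every variable are closed immersions

Family `hodge`, layer `Literature/AlgebraicGeometry/Motives`. PROOF FILE (theorems only) completing
`Motives/ProjectiveSpaceLinearMaps`: for linear forms `τ₀, …, τ_N ∈ k[y₀, …, y_r]` such that every
variable `y_j` is one of the `τᵢ` (the standing hypothesis `hgen` of `ProjectiveSpace.linSubstMap`),
the substitution `σ_τ : k[x₀, …, x_N] → k[y₀, …, y_r]` is a SURJECTIVE graded `k`-algebra map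
(`k[y] ≅ k[x]/ker σ_τ`), so the linear map `ProjectiveSpace.linSubstMap τ : ℙʳ_k ⟶ ℙᴺ_k`
(`= Proj σ_τ`) is a **closed immersion** — Hartshorne II Ex. 3.12 (a): "`Proj S/I → Proj S` is a
closed immersion"; II Example 7.1.1 / I Ex. 2.11 (linear subspaces `ℙʳ ≅ L ⊆ ℙᴺ`).

The proof is the one of the coordinate embedding `ProjectiveSpace.skipMap`
(`Motives/ProjectiveSpaceCoordinateEmbedding`, of which this is the general linear case, same
skeleton): closed immersions are Zariski-local on the target (Mathlib
`IsZariskiLocalAtTarget.iff_of_iSup_eq_top`); over the chart `D₊(xᵢ)` of `ℙᴺ` the map restricts to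
`D₊(τᵢ) → D₊(xᵢ)`, which under `D₊ ≅ Spec (degree-0 localisation)` (Mathlib
`Proj.basicOpenIsoSpec`, `Proj.awayι_comp_map`) is `Spec` of the comorphism
`Away.map σ_τ xᵢ : k[x]_{(xᵢ)} → k[y]_{(τᵢ)}`, and that comorphism is onto
(`awayMap_linSubstGraded_surjective`: a fraction `g / τᵢᵐ`, `g` a form of degree `m`, is the image
of `g(x_{ρ 0}, …, x_{ρ r}) / xᵢᵐ` for any choice `ρ` with `τ_{ρ j} = y_j`), whence a closed
immersion (Mathlib `IsClosedImmersion.spec_of_surjective`). (When `τᵢ = 0` the chart `D₊(τᵢ)` is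
empty and the same argument goes through verbatim: `k[y]_{(0)} = 0`.)

* `aeval_rename_linSubstChoice` — the graded section `g ↦ g(x_ρ)` of `σ_τ`;
* `awayMap_linSubstGraded_surjective` — surjectivity of the comorphisms on the charts;
* `isClosedImmersion_linSubstMapHom`, `isClosedImmersion_linSubstMap_left` — **`linSubstMap τ` is a
  closed immersion** (theorems; use `haveI`).

Everything is proved; no definitions, no named facts.

## References

* R. Hartshorne, *Algebraic Geometry*, GTM 52 (1977): II Ex. 3.12 (a), II Example 7.1.1,
  I Ex. 2.11. [Hartshorne1977]
-/

noncomputable section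

open CategoryTheory AlgebraicGeometry HomogeneousLocalization MvPolynomial

universe u

namespace Literature.AlgebraicGeometry.Motives

namespace ProjectiveSpace

variable {k : Type u} [Field k] {N r : ℕ}

attribute [local instance] MvPolynomial.gradedAlgebra ProjBaseChange.algebraBase

/-- The grading of the source ring `k[x₀, …, x_N]` by degree (`ℙᴺ = Proj 𝓐`). -/
local notation "𝓐" => MvPolynomial.homogeneousSubmodule (Fin (N + 1)) k
/-- The grading of the target ring `k[y₀, …, y_r]` by degree (`ℙʳ = Proj 𝓑`). -/
local notation "𝓑" => MvPolynomial.homogeneousSubmodule (Fin (r + 1)) k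

variable (τ : Fin (N + 1) → MvPolynomial (Fin (r + 1)) k) (hτ : ∀ i, (τ i).IsHomogeneous 1)
  (hgen : ∀ j : Fin (r + 1), ∃ i, τ i = X j)

/-! ### A graded section of the substitution -/

include hgen in
/-- **A graded set-theoretic section of `σ_τ`**: substituting `x_{ρ j}` for `y_j`, where `ρ j` is
any index with `τ_{ρ j} = y_j`, and then applying `σ_τ` gives back the polynomial
(`σ_τ (g(x_ρ)) = g(τ_ρ) = g(y)`; Mathlib `aeval_rename`). [folklore] -/
theorem aeval_rename_linSubstChoice (g : MvPolynomial (Fin (r + 1)) k) :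
    aeval τ (rename (fun j ↦ Classical.choose (hgen j)) g) = g := by
  rw [aeval_rename]
  have hρ : (τ ∘ fun j ↦ Classical.choose (hgen j)) = X :=
    funext fun j ↦ Classical.choose_spec (hgen j)
  rw [hρ, aeval_X_left_apply]

include hgen in
/-- The section preserves degrees: `g(x_ρ)` is a form of degree `m` if `g` is
(Mathlib `IsHomogeneous.rename_isHomogeneous`). [folklore] -/
theorem rename_linSubstChoice_mem {m : ℕ} {g : MvPolynomial (Fin (r + 1)) k} (hg : g ∈ 𝓑 m) :
    rename (fun j ↦ Classical.choose (hgen j)) g ∈ 𝓐 m :=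
  (mem_homogeneousSubmodule m _).mpr (((mem_homogeneousSubmodule m g).mp hg).rename_isHomogeneous)

/-- **Surjectivity of the comorphism on the charts**: `Away.map σ_τ xᵢ : k[x]_{(xᵢ)} → k[y]_{(τᵢ)}`
is onto — a fraction `g / τᵢᵐ` is the image of `g(x_ρ) / xᵢᵐ`. This is the ring-theoretic content
of "`Proj` of a surjective graded map is a closed immersion". [cite: Hartshorne1977, II Ex. 3.12] -/
theorem awayMap_linSubstGraded_surjective (hgen : ∀ j : Fin (r + 1), ∃ i, τ i = X j) (i : Fin (N + 1)) :
    Function.Surjective (Away.map (linSubstGraded τ hτ) (X i : MvPolynomial (Fin (N + 1)) k)) := by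
  intro q
  have hXi : linSubstGraded τ hτ (X i : MvPolynomial (Fin (N + 1)) k) ∈ 𝓑 1 :=
    (linSubstGraded τ hτ).map_mem (X_mem i)
  obtain ⟨m, g, hg, rfl⟩ := Away.mk_surjective 𝓑 hXi q
  refine ⟨Away.mk 𝓐 (X_mem i) m (rename (fun j ↦ Classical.choose (hgen j)) g)
    (rename_linSubstChoice_mem τ hgen hg), ?_⟩
  rw [Away.map_mk]
  congr 1
  exact aeval_rename_linSubstChoice τ hgen g

/-! ### `linSubstMap` is a closed immersion -/

/-- **The chart square**: on `D₊(τᵢ) = (linSubstMapHom τ)⁻¹ D₊(xᵢ)` the restriction of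
`linSubstMapHom τ` (Mathlib `Scheme.Hom.resLE`), conjugated by the isomorphisms
`D₊ ≅ Spec (Away)` (Mathlib `Proj.basicOpenIsoSpec`), is `Spec` of the comorphism
`Away.map σ_τ xᵢ` (Mathlib `Proj.awayι_comp_map`, `Proj.ι_comp_map`). [folklore] -/
theorem basicOpenIsoSpec_inv_comp_resLE_linSubstMapHom (i : Fin (N + 1)) :
    (Proj.basicOpenIsoSpec 𝓑 (linSubstGraded τ hτ (X i))
        ((linSubstGraded τ hτ).map_mem (X_mem i)) one_pos).inv ≫
        (linSubstMapHom τ hτ hgen).resLE (Proj.basicOpen 𝓐 (X i))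
          (Proj.basicOpen 𝓑 (linSubstGraded τ hτ (X i))) le_rfl =
      Spec.map (CommRingCat.ofHom (Away.map (linSubstGraded τ hτ) (X i : MvPolynomial (Fin (N + 1)) k))) ≫
        (Proj.basicOpenIsoSpec 𝓐 (X i) (X_mem i) one_pos).inv := by
  have h1 : (linSubstMapHom τ hτ hgen).resLE (Proj.basicOpen 𝓐 (X i))
      (Proj.basicOpen 𝓑 (linSubstGraded τ hτ (X i))) le_rfl ≫
        (Proj.basicOpen 𝓐 (X i : MvPolynomial (Fin (N + 1)) k)).ι =
      (Proj.basicOpen 𝓑 (linSubstGraded τ hτ (X i))).ι ≫ linSubstMapHom τ hτ hgen :=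
    (Proj.ι_comp_map (linSubstGraded τ hτ) (irrelevant_le_map_linSubstGraded τ hτ hgen) (X i)).symm
  rw [← cancel_mono (Proj.basicOpen 𝓐 (X i : MvPolynomial (Fin (N + 1)) k)).ι,
    Category.assoc, Category.assoc, h1, Proj.basicOpenIsoSpec_inv_ι_assoc, Proj.basicOpenIsoSpec_inv_ι,
    linSubstMapHom_eq, Proj.awayι_comp_map _ _ one_pos (X i) (X_mem i)]

/-- Over the chart `D₊(xᵢ)` the restriction of `linSubstMapHom τ` is a closed immersion (`Spec` of
the surjection `Away.map σ_τ xᵢ`, `awayMap_linSubstGraded_surjective`, Mathlib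
`IsClosedImmersion.spec_of_surjective`; closed immersions respect isomorphisms).
[cite: Hartshorne1977, II Ex. 3.12] -/
theorem isClosedImmersion_linSubstMapHom_morphismRestrict (i : Fin (N + 1)) :
    IsClosedImmersion (linSubstMapHom τ hτ hgen ∣_ Proj.basicOpen 𝓐 (X i)) := by
  have hspec : IsClosedImmersion (Spec.map (CommRingCat.ofHom
      (Away.map (linSubstGraded τ hτ) (X i : MvPolynomial (Fin (N + 1)) k)))) :=
    IsClosedImmersion.spec_of_surjective _ (awayMap_linSubstGraded_surjective τ hτ hgen i)
  have h2 : IsClosedImmersion (Spec.map (CommRingCat.ofHom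
      (Away.map (linSubstGraded τ hτ) (X i : MvPolynomial (Fin (N + 1)) k))) ≫
        (Proj.basicOpenIsoSpec 𝓐 (X i) (X_mem i) one_pos).inv) :=
    (MorphismProperty.cancel_right_of_respectsIso @IsClosedImmersion _ _).mpr hspec
  rw [← basicOpenIsoSpec_inv_comp_resLE_linSubstMapHom τ hτ hgen i] at h2
  have h3 := (MorphismProperty.cancel_left_of_respectsIso @IsClosedImmersion _ _).mp h2
  have key : linSubstMapHom τ hτ hgen ∣_ Proj.basicOpen 𝓐 (X i) =
      (linSubstMapHom τ hτ hgen).resLE (Proj.basicOpen 𝓐 (X i))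
        (Proj.basicOpen 𝓑 (linSubstGraded τ hτ (X i))) le_rfl :=
    (Scheme.Hom.resLE_eq_morphismRestrict (linSubstMapHom τ hτ hgen)
      (U := Proj.basicOpen 𝓐 (X i))).symm
  rw [key]
  exact h3

/-- **The linear map `ℙʳ_k → ℙᴺ_k` of a substitution hitting every variable is a closed
immersion** (closed immersions are Zariski-local on the target; over the cover of `ℙᴺ` by the
`D₊(xᵢ)` it is `Spec` of a surjection — Hartshorne II Ex. 3.12 (a), "`Proj S/I → Proj S` is a
closed immersion" for `S/I = k[x]/ker σ_τ ≅ k[y]`; linear subspaces, II Example 7.1.1).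
[cite: Hartshorne1977, II Ex. 3.12] -/
theorem isClosedImmersion_linSubstMapHom : IsClosedImmersion (linSubstMapHom τ hτ hgen) := by
  refine (IsZariskiLocalAtTarget.iff_of_iSup_eq_top (P := @IsClosedImmersion)
    (fun i : Fin (N + 1) ↦ Proj.basicOpen 𝓐 (X i : MvPolynomial (Fin (N + 1)) k))
    (Proj.iSup_basicOpen_eq_top 𝓐 _ (irrelevant_le_span N k))).mpr fun i ↦ ?_
  exact isClosedImmersion_linSubstMapHom_morphismRestrict τ hτ hgen i

/-- `linSubstMap τ` is a closed immersion of `k`-schemes. [cite: Hartshorne1977, II Ex. 3.12] -/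
theorem isClosedImmersion_linSubstMap_left : IsClosedImmersion (linSubstMap τ hτ hgen).left :=
  isClosedImmersion_linSubstMapHom τ hτ hgen

end ProjectiveSpace

end Literature.AlgebraicGeometry.Motives

end
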